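import Summits.QuantumFields.YangMills.Theorems.FlatTubeReductionBORateBricksCore
import Summits.QuantumFields.YangMills.Theorems.FlatTubeReductionDressedOneOrbitRatePot
import Summits.QuantumFields.YangMills.Theorems.FlatTubeReductionSoftTubeRatePot
import HarnessLib

/-!
# `BORateBricksPot`: the rate-grade Born–Oppenheimer brick list of skeleton «ratepack-v3 / frozen fibres» — `BORateBricksCore` with the off-diagonal brick (B-OD) budgeted
# by a SECOND-MOMENT POTENTIAL instead of a uniform `b² = O(λ_b²)`
# (route `FlatTubeReduction`, crux K1 `NearFlatRatioLaw` stmt-QuantumFields-24720; seat `ym-line-ftr-p1` g12; R2b1 RECORD rung — no summit statement is proved here)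

WHY (lead g12, crux workfile `Cruxes/NearFlatRatioLaw/Lines/ratepack-v3-frozen-g12.md`): with a FROZEN fibre profile `Ω` (independent of the slow point, e.g. lane A's
`frozenProfile`) the Feshbach coupling between `boFunAd φ Ω` and the fibrewise-orthogonal sector is FIRST order in the slow amplitude; the honest (B-OD) estimate is
`|X(boFunAd φ Ω, v)| ≤ σμ₀·√(b₀²‖boFunAd φ Ω‖² + κ_bγ∫_{orbitDist<δ₁} orbitDist²·φ²)·‖v‖` with `b₀² = O(λ_b²)` (slow-kinetic cross term, even `O(λ_b³)`) and `κ_b = O(1)`.  The extra term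
is a second-moment POTENTIAL on the slow coefficient; it is `O(λ_b)·μ₀` at the edge of the `β^{-1/6}` core (so no uniform `b² = O(λ_b²)`), but the one-site sub-target (EM) absorbs it
(`dressedOneOrbitRatePot_of_eigenMoments`, p673495) exactly like the dressing.  So the rate twin of the crux needs NO adapted fibres.
* `BORateBricksPot L χ δ` — `BORateBricksCore` (p661687) with: `hOD` replaced by the potential form `hODpot` (for COLOUR-INVARIANT slow amplitudes `φ`; weaker, hence easier),
  a new constant `κ_b ≥ 0`, and the window condition `(4κ_b/θ₀)·δ₁² ≤ Aλ_b(L³β)` next to `κ_Wδ₁² ≤ Aλ_b(L³β)` (both hold for `δ₁ = cβ^{-1/6}`).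
* ★★ `BORateBricksPot.hDSpot` — (EM) ⟹ the dressed one-site no-intruder WITH POTENTIAL at every level, reindexed to `β = B/L³` (the `hDOS` input of `slow_rate_clause_of_dressed_pot`).
The assembly `BORateBricksPot → RateTube.SoftTubeBORatePackagePotOn` and the chain to K1 are `Theorems/FlatTubeReductionBOAssemblyRatePot.lean`.
HONEST FRAMING: a typed hand-off object; the analytic fields (B-N), (B-T)-rate (exact-diagonal dressing), (B-ST), (B-OD)-potential and `hTop` are OPEN fixed-lattice
semiclassics on `SU(2)^{3L³}` (pooled with RED lane A's frozen-fibre (B-T) pen); femto rung R2b1 (RECORD label); not infinite volume, not a gap, not Clay.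
One new `structure`, no named facts, no `sorry`.
-/

set_option autoImplicit false

noncomputable section

open MeasureTheory Filter Topology Real
open scoped BigOperators
open Literature.MathematicalPhysics.QuantumFieldTheory
open Literature.MathematicalPhysics.QuantumLattice

namespace Summit.QuantumFields.YangMills.Theorems.FemtoTransferGap.RateTube

open Summit.QuantumFields.YangMills.Theorems.FemtoTransferGap
open Summit.QuantumFields.YangMills.Theorems.FemtoTransferGap.TwoLattice.Avg
open Summit.QuantumFields.YangMills.Theorems.FemtoTransferGap.TwoLattice.ConstTube
open Summit.QuantumFields.YangMills.Theorems.FemtoTransferGap.TwoLattice.Stiff (LinkSpace)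
open Summit.QuantumFields.YangMills.Theorems.FemtoCutoffLadder

variable (L : ℕ) [NeZero L]

/-! ## §1 The brick list with a second-moment off-diagonal budget -/

/-- **THE RATE-GRADE BORN–OPPENHEIMER BRICK LIST WITH A SECOND-MOMENT OFF-DIAGONAL BUDGET** («ratepack-v3»; frozen fibres admissible): `BORateBricksCore` with (B-OD) in
potential form — for colour-invariant slow amplitudes `φ` supported in the window and fibrewise-orthogonal `v`,
`|X(boFunAd φ Ω, v)|, |X(v, boFunAd φ Ω)| ≤ σμ₀·√(b²‖boFunAd φ Ω‖²_w + κ_b·γ·∫_{orbitDist<δ₁} orbitDist²φ²)·‖v‖_w` — and the window condition `(4κ_b/θ₀)δ₁² ≤ Aλ_b(L³β)`.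
[cite: Luscher1983, §3] [cite: SjostrandZworski2007, §2] -/
structure BORateBricksPot (χ : ℝ → GaugeConfig 3 L SU2 → ℝ) (δ : ℝ → ℝ) where
  /-- fibre profile `Ω β u v` (equivariant under global colour rotations; may be FROZEN, i.e. independent of `u`) -/
  Ω : ℝ → GaugeConfig 3 1 SU2 → LinkSpace L → ℝ
  /-- DRESSED one-site weight `W β u` (exact diagonal ratio of the fibre-sandwiched kernel), physical, two-sided near the vacuum -/
  W : ℝ → GaugeConfig 3 1 SU2 → ℝ
  /-- slow window -/
  𝒰 : ℝ → Set (GaugeConfig 3 1 SU2)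
  /-- fibre energy factor, fibre mass, relative error, uniform off-diagonal size, lower bound of `χ` on its support -/
  σ : ℝ → ℝ
  γ : ℝ → ℝ
  κ : ℝ → ℝ
  b : ℝ → ℝ
  c : ℝ → ℝ
  /-- stiff gap, one-site window radius, BO support radius, copy margin -/
  θ₀ : ℝ
  δ₁ : ℝ → ℝ
  δ₂ : ℝ → ℝ
  m : ℝ
  -- structural hypotheses
  hχm : ∀ β, Measurable (χ β)
  hχ1 : ∀ β U, |χ β U| ≤ 1
  hχ0 : ∀ β U, 0 ≤ χ β U
  hc : ∀ β, 0 < c β ∧ ∀ U, χ β U ≠ 0 → c β ≤ χ β U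
  hwm : ∀ β, Measurable (softWeight (χ β))
  hwb : ∀ β, ∃ Cw : ℝ, ∀ U, |softWeight (χ β) U| ≤ Cw
  hw0 : ∀ β U, 0 ≤ softWeight (χ β) U
  hwinv : ∀ β (g : SU2) (U : GaugeConfig 3 L SU2), softWeight (χ β) (gaugeTransform (fun _ : Site 3 L => g) U) = softWeight (χ β) U
  hΩm : ∀ β, Measurable (Function.uncurry (Ω β))
  hΩ1 : ∀ β u x, |Ω β u x| ≤ 1
  hΩinv : ∀ β (g : SU2) (u : GaugeConfig 3 1 SU2) (v : LinkSpace L), Ω β (gaugeTransform (fun _ : Site 3 1 => g) u) (adL L g v) = Ω β u v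
  /-- the dressed weight is PHYSICAL, nonnegative, uniformly bounded -/
  hWphys : ∀ β, IsPhys (W β)
  hW0 : ∀ β u, 0 ≤ W β u
  CW : ℝ
  hWbU : ∀ β u, |W β u| ≤ CW
  /-- two-sided vacuum behaviour `|W² − 1| ≤ κ_W·orbitDist²` on the slow window; potential constant `κ_b`; the window is a rate CORE for BOTH: `κ_Wδ₁² ≤ Aλ_b`, `(4κ_b/θ₀)δ₁² ≤ Aλ_b` -/
  κW : ℝ
  κb : ℝ
  A : ℝ
  hκW : 0 ≤ κW
  hκb : 0 ≤ κb
  hA : 0 ≤ A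
  hWsq : ∀ β u, orbitDist u < δ₁ β → |W β u ^ 2 - 1| ≤ κW * orbitDist u ^ 2
  hδ₁win : ∃ β1 : ℝ, ∀ β : ℝ, β1 ≤ β → 0 < δ₁ β ∧ δ₁ β ≤ 1 / 2 ∧ κW * δ₁ β ^ 2 ≤ A * bareLambda ((L : ℝ) ^ 3 * β) ∧
    4 * κb / θ₀ * δ₁ β ^ 2 ≤ A * bareLambda ((L : ℝ) ^ 3 * β)
  h𝒰m : ∀ β, MeasurableSet (𝒰 β)
  h𝒰inv : ∀ β (g : SU2) (u : GaugeConfig 3 1 SU2), gaugeTransform (fun _ : Site 3 1 => g) u ∈ 𝒰 β ↔ u ∈ 𝒰 β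
  h𝒰δ₁ : ∀ β, ∀ u ∈ 𝒰 β, orbitDist u < δ₁ β
  hδ₁ : ∀ᶠ β in atTop, δ₁ β ≤ 1 / 2
  htube : ∀ᶠ β in atTop, ∀ U, χ β U ≠ 0 → U ∈ orthoTubeSet L
  hshadow : ∀ᶠ β in atTop, ∀ U, χ β U ≠ 0 → orbitDist U < δ β → slowMean L U ∈ 𝒰 β
  hbo : ∀ᶠ β in atTop, ∀ (φ : GaugeConfig 3 1 SU2 → ℝ) (U : GaugeConfig 3 L SU2), (∀ u, φ u ≠ 0 → u ∈ 𝒰 β) → boFunAd L φ (Ω β) U ≠ 0 → χ β U ≠ 0 ∧ orbitDist U < δ₂ β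
  hm : 0 ≤ m
  hm0 : 0 < m
  hδ₂ : ∀ᶠ β in atTop, (L : ℝ) * (δ₂ β + m) < 2
  hσ : ∀ β, 0 < σ β
  hγ : ∀ β, 0 < γ β
  hκ : ∀ β, 0 ≤ κ β
  hb : ∀ β, 0 ≤ b β
  hθ₀ : 0 < θ₀ ∧ θ₀ ≤ 1
  hκ_small : ∃ a : ℝ, ∀ᶠ β in atTop, κ β ≤ a * bareLambda ((L : ℝ) ^ 3 * β) ^ 2
  hb_small : ∃ a : ℝ, ∀ᶠ β in atTop, b β ^ 2 ≤ a * bareLambda ((L : ℝ) ^ 3 * β) ^ 2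
  -- the analytic bricks (RATE grade: `κ, b² = O(λ_b²)`; DRESSED one-site form `⟨φW, K_BφW⟩`; off-diagonal with potential)
  hTop : ∃ C'' : ℝ, ∀ᶠ β in atTop, ∃ φ₀ : GaugeConfig 3 1 SU2 → ℝ, Measurable φ₀ ∧ (∃ C : ℝ, ∀ u, |φ₀ u| ≤ C) ∧
    (∀ (g : Site 3 1 → SU2) (u : GaugeConfig 3 1 SU2), φ₀ (gaugeTransform g u) = φ₀ u) ∧ (∀ u, φ₀ u ≠ 0 → u ∈ 𝒰 β) ∧ 0 < l2 φ₀ φ₀ ∧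
    Real.exp (-(C'' * bareLambda ((L : ℝ) ^ 3 * β) ^ 2)) * levelValue su2Rep 1 ((L : ℝ) ^ 3 * β) 0 * l2 φ₀ φ₀ ≤
      qform su2Rep ((L : ℝ) ^ 3 * β) (fun u => φ₀ u * W β u) (fun u => φ₀ u * W β u)
  hN : ∀ᶠ β in atTop, ∀ u ∈ 𝒰 β, |fibreMassAd L (softWeight (χ β)) (Ω β) u - γ β| ≤ κ β * γ β
  hT : ∀ᶠ β in atTop, ∀ φ : GaugeConfig 3 1 SU2 → ℝ, Measurable φ → (∃ C : ℝ, ∀ u, |φ u| ≤ C) →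
    (∀ (g : Site 3 1 → SU2) (u : GaugeConfig 3 1 SU2), φ (gaugeTransform g u) = φ u) → (∀ u, φ u ≠ 0 → u ∈ 𝒰 β) →
    |tubeForm β (boFunAd L φ (Ω β)) - σ β * γ β * qform su2Rep ((L : ℝ) ^ 3 * β) (fun u => φ u * W β u) (fun u => φ u * W β u)| ≤
      κ β * (σ β * γ β) * (qform su2Rep ((L : ℝ) ^ 3 * β) (fun u => φ u * W β u) (fun u => φ u * W β u) + levelValue su2Rep 1 ((L : ℝ) ^ 3 * β) 0 * l2 φ φ)
  hST : ∀ᶠ β in atTop, ∀ v : GaugeConfig 3 L SU2 → ℝ, Measurable v → (∃ C : ℝ, ∀ U, |v U| ≤ C) → (∀ U, v U ≠ 0 → χ β U ≠ 0) →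
    (∀ u, fibreInnerAd L (softWeight (χ β)) (Ω β) v u = 0) →
    tubeForm β v ≤ (1 - θ₀) * (σ β * levelValue su2Rep 1 ((L : ℝ) ^ 3 * β) 0) * tubeNormSq (softWeight (χ β)) v
  hODpot : ∀ᶠ β in atTop, ∀ (φ : GaugeConfig 3 1 SU2 → ℝ) (v : GaugeConfig 3 L SU2 → ℝ), Measurable φ → (∃ C : ℝ, ∀ u, |φ u| ≤ C) →
    (∀ (g : Site 3 1 → SU2) (u : GaugeConfig 3 1 SU2), φ (gaugeTransform g u) = φ u) → (∀ u, φ u ≠ 0 → u ∈ 𝒰 β) →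
    Measurable v → (∃ C : ℝ, ∀ U, |v U| ≤ C) → (∀ U, v U ≠ 0 → χ β U ≠ 0) → (∀ u, fibreInnerAd L (softWeight (χ β)) (Ω β) v u = 0) →
    |tubeCross β (boFunAd L φ (Ω β)) v| ≤ (σ β * levelValue su2Rep 1 ((L : ℝ) ^ 3 * β) 0) *
        Real.sqrt (b β ^ 2 * tubeNormSq (softWeight (χ β)) (boFunAd L φ (Ω β)) +
          κb * γ β * ∫ u, (if orbitDist u < δ₁ β then orbitDist u ^ 2 else 0) * φ u ^ 2 ∂configMeasure SU2 1) * Real.sqrt (tubeNormSq (softWeight (χ β)) v) ∧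
    |tubeCross β v (boFunAd L φ (Ω β))| ≤ (σ β * levelValue su2Rep 1 ((L : ℝ) ^ 3 * β) 0) *
        Real.sqrt (b β ^ 2 * tubeNormSq (softWeight (χ β)) (boFunAd L φ (Ω β)) +
          κb * γ β * ∫ u, (if orbitDist u < δ₁ β then orbitDist u ^ 2 else 0) * φ u ^ 2 ∂configMeasure SU2 1) * Real.sqrt (tubeNormSq (softWeight (χ β)) v)

/-! ## §2 ★★ (EM) gives the dressed one-site no-intruder WITH POTENTIAL at `B = L³β` -/

variable {L}

set_option maxHeartbeats 400000 in
/-- ★★ **`hDS′` from (EM)**: for every level `k` there is `C_D` such that eventually in `β`, every bounded measurable gauge-invariant `(k+1)`-family `G` supported in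
`{orbitDist < δ₁ β}` has `a ≠ 0` with `(⟨(ΣaG)W, K_{L³β}(ΣaG)W⟩ + (4κ_b/θ₀)·μ₀·∫_{orbitDist<δ₁} orbitDist²(ΣaG)²)·μ₀ ≤ e^{C_Dλ_b(L³β)²}μ_kμ₀‖ΣaG‖²` —
`dressedOneOrbitRatePot_of_eigenMoments` at the one-site coupling `B = L³β`, weights and window reindexed by `β = B/L³`. [cite: Luscher1983, §3] -/
theorem BORateBricksPot.hDSpot (hEM : OneSiteEigenMoments) {χ : ℝ → GaugeConfig 3 L SU2 → ℝ} {δ : ℝ → ℝ} (K : BORateBricksPot L χ δ) (k : ℕ) :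
    ∃ CD : ℝ, ∀ᶠ β in atTop, ∀ G : Fin (k + 1) → (GaugeConfig 3 1 SU2 → ℝ), (∀ i, Measurable (G i)) → (∀ i, ∃ C : ℝ, ∀ u, |G i u| ≤ C) →
      (∀ i (g : Site 3 1 → SU2) (u : GaugeConfig 3 1 SU2), G i (gaugeTransform g u) = G i u) → (∀ i u, G i u ≠ 0 → orbitDist u < K.δ₁ β) →
        ∃ a : Fin (k + 1) → ℝ, a ≠ 0 ∧
          (qform su2Rep ((L : ℝ) ^ 3 * β) (fun u => (∑ i, a i * G i u) * K.W β u) (fun u => (∑ i, a i * G i u) * K.W β u) +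
              4 * K.κb / K.θ₀ * levelValue su2Rep 1 ((L : ℝ) ^ 3 * β) 0 *
                ∫ u, (if orbitDist u < K.δ₁ β then orbitDist u ^ 2 else 0) * (∑ i, a i * G i u) ^ 2 ∂configMeasure SU2 1) * levelValue su2Rep 1 ((L : ℝ) ^ 3 * β) 0 ≤
            Real.exp (CD * bareLambda ((L : ℝ) ^ 3 * β) ^ 2) * levelValue su2Rep 1 ((L : ℝ) ^ 3 * β) k * levelValue su2Rep 1 ((L : ℝ) ^ 3 * β) 0 *
              l2 (fun u => ∑ i, a i * G i u) (fun u => ∑ i, a i * G i u) := by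
  have hL3 : (0 : ℝ) < (L : ℝ) ^ 3 := pow_pos (by exact_mod_cast Nat.pos_of_ne_zero (NeZero.ne L)) 3
  have hκE : 0 ≤ 4 * K.κb / K.θ₀ := div_nonneg (by linarith [K.hκb]) K.hθ₀.1.le
  -- reindex the window condition by the one-site coupling `B = L³β`
  obtain ⟨β1, hwin⟩ := K.hδ₁win
  have hδ' : ∃ B1 : ℝ, ∀ B : ℝ, B1 ≤ B → 0 < K.δ₁ (B / (L : ℝ) ^ 3) ∧ K.δ₁ (B / (L : ℝ) ^ 3) ≤ 1 / 2 ∧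
      K.κW * K.δ₁ (B / (L : ℝ) ^ 3) ^ 2 ≤ K.A * bareLambda B ∧ 4 * K.κb / K.θ₀ * K.δ₁ (B / (L : ℝ) ^ 3) ^ 2 ≤ K.A * bareLambda B := by
    refine ⟨(L : ℝ) ^ 3 * max β1 0, fun B hB => ?_⟩
    have hb : β1 ≤ B / (L : ℝ) ^ 3 := by
      rw [le_div_iff₀ hL3]; nlinarith [le_max_left β1 0, le_max_right β1 0]
    obtain ⟨h1, h2, h3, h4⟩ := hwin _ hb
    have e : (L : ℝ) ^ 3 * (B / (L : ℝ) ^ 3) = B := by rw [← mul_div_assoc, mul_comm ((L : ℝ) ^ 3) B, mul_div_assoc, div_self hL3.ne', mul_one]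
    rw [e] at h3 h4
    exact ⟨h1, h2, h3, h4⟩
  obtain ⟨C, B₀, h⟩ := dressedOneOrbitRatePot_of_eigenMoments hEM k (δ := fun B => K.δ₁ (B / (L : ℝ) ^ 3)) (W := fun B => K.W (B / (L : ℝ) ^ 3))
    K.hκW K.hA hκE (fun B => K.hWphys _) (fun B u => K.hWbU _ u) (fun B u => K.hW0 _ u) (fun B u hu => K.hWsq _ u hu) hδ'
  refine ⟨C, ?_⟩
  filter_upwards [Filter.eventually_ge_atTop (B₀ / (L : ℝ) ^ 3)] with β hβ
  have hB : B₀ ≤ (L : ℝ) ^ 3 * β := by rw [div_le_iff₀ hL3] at hβ; linarith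
  have e : (L : ℝ) ^ 3 * β / (L : ℝ) ^ 3 = β := by rw [mul_comm, mul_div_assoc, div_self hL3.ne', mul_one]
  have h' := h ((L : ℝ) ^ 3 * β) hB
  simp only [e] at h'
  intro G hGm hGb hGg hGs
  exact h' G hGm hGb hGg hGs

/-- ★ **v2's hand-off object implies v3's**: a UNIFORM off-diagonal budget (`BORateBricksCore.hOD`, p661687) is the case `κ_b = 0` of the potential form, so
`BORateBricksCore → BORateBricksPot` (v3 asks for less). [folklore] -/
def BORateBricksPot.ofCore {χ : ℝ → GaugeConfig 3 L SU2 → ℝ} {δ : ℝ → ℝ} (K : BORateBricksCore L χ δ) : BORateBricksPot L χ δ where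
  Ω := K.Ω
  W := K.W
  𝒰 := K.𝒰
  σ := K.σ
  γ := K.γ
  κ := K.κ
  b := K.b
  c := K.c
  θ₀ := K.θ₀
  δ₁ := K.δ₁
  δ₂ := K.δ₂
  m := K.m
  hχm := K.hχm
  hχ1 := K.hχ1
  hχ0 := K.hχ0
  hc := K.hc
  hwm := K.hwm
  hwb := K.hwb
  hw0 := K.hw0
  hwinv := K.hwinv
  hΩm := K.hΩm
  hΩ1 := K.hΩ1
  hΩinv := K.hΩinv
  hWphys := K.hWphys
  hW0 := K.hW0
  CW := K.CW
  hWbU := K.hWbU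
  κW := K.κW
  κb := 0
  A := K.A
  hκW := K.hκW
  hκb := le_rfl
  hA := K.hA
  hWsq := K.hWsq
  hδ₁win := by
    obtain ⟨β1, h⟩ := K.hδ₁win
    refine ⟨max β1 1, fun β hβ => ?_⟩
    obtain ⟨h1, h2, h3⟩ := h β ((le_max_left _ _).trans hβ)
    refine ⟨h1, h2, h3, ?_⟩
    have hβ0 : 0 < β := by linarith [le_max_right β1 1]
    have hL3 : (0 : ℝ) < (L : ℝ) ^ 3 := pow_pos (by exact_mod_cast Nat.pos_of_ne_zero (NeZero.ne L)) 3
    rw [mul_zero, zero_div, zero_mul]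
    exact mul_nonneg K.hA (bareLambda_pos' (by positivity)).le
  h𝒰m := K.h𝒰m
  h𝒰inv := K.h𝒰inv
  h𝒰δ₁ := K.h𝒰δ₁
  hδ₁ := K.hδ₁
  htube := K.htube
  hshadow := K.hshadow
  hbo := K.hbo
  hm := K.hm
  hm0 := K.hm0
  hδ₂ := K.hδ₂
  hσ := K.hσ
  hγ := K.hγ
  hκ := K.hκ
  hb := K.hb
  hθ₀ := K.hθ₀
  hκ_small := K.hκ_small
  hb_small := K.hb_small
  hTop := K.hTop
  hN := K.hN
  hT := K.hT
  hST := K.hST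
  hODpot := by
    filter_upwards [K.hOD] with β hOD
    intro φ v hφm hφb _hφg hφs hvm hvb hvs hvo
    obtain ⟨h1, h2⟩ := hOD φ v hφm hφb hφs hvm hvb hvs hvo
    have hN0 : 0 ≤ tubeNormSq (softWeight (χ β)) (boFunAd L φ (K.Ω β)) := integral_nonneg fun U => mul_nonneg (sq_nonneg _) (K.hw0 β U)
    have e : Real.sqrt (K.b β ^ 2 * tubeNormSq (softWeight (χ β)) (boFunAd L φ (K.Ω β)) +
          0 * K.γ β * ∫ u, (if orbitDist u < K.δ₁ β then orbitDist u ^ 2 else 0) * φ u ^ 2 ∂configMeasure SU2 1) =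
        K.b β * Real.sqrt (tubeNormSq (softWeight (χ β)) (boFunAd L φ (K.Ω β))) := by
      rw [zero_mul, zero_mul, add_zero, Real.sqrt_mul' _ hN0, Real.sqrt_sq (K.hb β)]
    rw [e]
    constructor
    · calc |tubeCross β (boFunAd L φ (K.Ω β)) v| ≤ K.b β * (K.σ β * levelValue su2Rep 1 ((L : ℝ) ^ 3 * β) 0) *
            Real.sqrt (tubeNormSq (softWeight (χ β)) (boFunAd L φ (K.Ω β))) * Real.sqrt (tubeNormSq (softWeight (χ β)) v) := h1
        _ = K.σ β * levelValue su2Rep 1 ((L : ℝ) ^ 3 * β) 0 * (K.b β * Real.sqrt (tubeNormSq (softWeight (χ β)) (boFunAd L φ (K.Ω β)))) *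
            Real.sqrt (tubeNormSq (softWeight (χ β)) v) := by ring
    · calc |tubeCross β v (boFunAd L φ (K.Ω β))| ≤ K.b β * (K.σ β * levelValue su2Rep 1 ((L : ℝ) ^ 3 * β) 0) *
            Real.sqrt (tubeNormSq (softWeight (χ β)) (boFunAd L φ (K.Ω β))) * Real.sqrt (tubeNormSq (softWeight (χ β)) v) := h2
        _ = K.σ β * levelValue su2Rep 1 ((L : ℝ) ^ 3 * β) 0 * (K.b β * Real.sqrt (tubeNormSq (softWeight (χ β)) (boFunAd L φ (K.Ω β)))) *
            Real.sqrt (tubeNormSq (softWeight (χ β)) v) := by ring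

end Summit.QuantumFields.YangMills.Theorems.FemtoTransferGap.RateTube

end
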